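/-
Copyright (c) 2026 the pub-hodgecm-mathlib formalisation cell (harness21).  Prover seat hodgecm-mathlib-R90-C14-p01 (g0), R90-TF section S8 «ContSpec-n½» (dealer R90-CS-plan (g0);
TWIN-DAG v1 row 2, prerequisite of the dealt row 6, 2026-09-04T16:22:13Z), h413 = `stmt-HodgeConjecture-24833`: the `U(2,1)` ∕ PAIR-currency twin of ★ `K2E1ChiEisensteinConstantTermCMTwo` —
the Borel constant term of the `(χ₁, χ₂)`-Eisenstein series of `U(2,1)_{L∕L⁺}` on the half-plane of convergence `Re z > 2`.
-/
import Summits.HodgeConjecture.HodgeConjecture.Theorems.K2E1CharacterEisensteinU3PairDefs   -- ★ D-S8-3 p861816 (K2-defs1): `IsChiSectionPair χ₁ χ₂` (+ `.unipotent_mul`, `.toAdelic_mul`)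
import Summits.HodgeConjecture.HodgeConjecture.Theorems.K2E1EisensteinAnalyticBinders        -- ★ (K2E1-p09): `hfin_of_locallyUniformMajorant`; brings ★ CT `borelConstantTerm_eisensteinSeriesU_three` (`K2E1EisensteinSeriesLeftRight`)
import Summits.HodgeConjecture.HodgeConjecture.Theorems.K2E1BorelEisensteinGodementCMThree    -- ★ (K2E3 lineage): `exists_locallyUniform_majorant_flatSectionU_cm_three` (bounded `φ`, `2 < Re z`)
import Summits.HodgeConjecture.HodgeConjecture.Theorems.K2E1HeisenbergHaarU3                  -- ★ (ν-2): `isInvInvariant_of_isHaarMeasure_adelicUnipotent_three`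
import Literature.NumberTheory.Automorphic.UnitaryGroupUnipotentUnimodularThree              -- ★ `measure_ne_zero_of_isFundamentalDomain_rationalUnipotent`
import HarnessLib

/-!
# K2·E1 ∕ R90-TF S8 — `K2E1ChiEisensteinConstantTermCMThree`: THE BOREL CONSTANT TERM OF THE `(χ₁, χ₂)`-EISENSTEIN SERIES OF `U(2,1)_{L∕L⁺}` ON THE HALF-PLANE OF CONVERGENCE,
# `E_B(f_z)(g) = f_z(g) + (ν𝓕)⁻¹ · ∫_{N(𝔸)} f_z(w₀ v g) dν(v)` (`2 < Re z`) — TWIN-DAG v1 row 2, the PAIR-currency twin of ★ `K2E1ChiEisensteinConstantTermCMTwo`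

Track B ∕ K2-LIT inside programme R90-TF (brief `director/R90-BRIEF.v2.md` 1f40d54518340a35), section S8 = continuous spectrum ∕ `n = ½` (base `R90-CS`), crux h413 =
`stmt-HodgeConjecture-24833`, route of record `HCCMUnconditional`; cell `hodgecm-mathlib`.  Prover seat `hodgecm-mathlib-R90-C14-p01` (g0); TWIN-DAG v1
(`K2/K2E1-p16/g2/TWIN-DAG.v1.K2E1-p16-g2.md` fdfe4481de4f802d) row 2, taken as the prerequisite of row 6 `K2E1ChiEisensteinDataCMThree` (dealer R90-CS-plan (g0) 16:22:13Z; my row-6 census on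
the R90 bus).  THEOREMS ONLY (no `def`, no `instance`, no notation, no named-fact hypothesis, no `sorry`); lane `--supports stmt-HodgeConjecture-24833 --as helper` (count-neutral).  Closes
no socket.

WHAT CHANGES AT `N = 3`.  The unipotent radical `N` of the Borel of `U(J₃)` is the Heisenberg group, but the Bruhat decomposition is still two-celled (rank one), so the constant term of the
left Eisenstein series along `B` has the same two-term shape as at `N = 2` — ★ `K2E1EisensteinSeriesLeftRight.borelConstantTerm_eisensteinSeriesU_three` (section-generic: `f` Borel,
left-`N(𝔸)`- and left-`B(F)`-invariant, `ν` left- and inversion-invariant, `0 < ν(𝓕) < ∞`, Godement finiteness `hfin` at `g`).  The half-plane of absolute convergence is `Re z > 2 = 2ρ_B`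
(★ `K2E1BorelEisensteinGodementCMThree.exists_locallyUniform_majorant_flatSectionU_cm_three`), inversion-invariance of the Haar measure of the (unimodular) Heisenberg group is ★
`K2E1HeisenbergHaarU3.isInvInvariant_of_isHaarMeasure_adelicUnipotent_three`.  And the character law is a PAIR (ruling S8-R10 (b), ★ D-S8-3 `IsChiSectionPair χ₁ χ₂`: `φ(b g) =
χ₁(b₀₀)·χ₂(b₁₁)·φ(g)`), whose left-`B(L⁺)`-invariance needs `χ₂` AUTOMORPHIC (★ `IsChiSectionPair.toAdelic_mul`) — the one new binder `hχ₂`.  §3 of the `U(1,1)` file (the reflected-section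
shape ★ `HasReflectedIntertwining`) is an `N = 2`-pinned DEFINITION and is not twinned here (a definitions-lane item).

* §1 `borelConstantTerm_eisensteinSeriesU_flatSectionU_cm_three` — SECTION-GENERIC: `φ` continuous, bounded, left-`N(𝔸_{L⁺})`- and left-`B(L⁺)`-invariant, `2 < Re z` (binders = the ★
  `_cm_two` §1's verbatim with `2 ↦ 3`, `1 < z.re ↦ 2 < z.re`).
* §2 `borelConstantTerm_chiPairEisenstein_cm_three` — the `(χ₁, χ₂)`-TWIN (`IsChiSectionPair χ₁ χ₂ φ`, `χ₂` automorphic, `φ` continuous and bounded), and its `ℂ`-multiplicative spelling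
  `borelConstantTerm_chiPairEisenstein_cm_three_eq_add_mul` (the shape the S2_χ letter `hct` of row 4b∕row 6 consumes).

HONEST LABEL: HC_CM is proved only modulo the 7 printed citations (2 remaining named inputs: hLiu418 = `stmt-HodgeConjecture-24832`, h413 = `stmt-HodgeConjecture-24833`) until rung 0
closes; this file asserts no named fact and closes no socket; unconditional (no letters).

## References
* [MoeglinWaldspurger1995] C. Mœglin, J.-L. Waldspurger, *Spectral decomposition and Eisenstein series* (1995), II.1.5 (convergence), II.1.7 (constant terms of Eisenstein series).
* [Rogawski1990] J. D. Rogawski, *Automorphic Representations of Unitary Groups in Three Variables*, Ann. of Math. Stud. 123 (1990), §2.2; §13.9 p. 229 («`χ = (φ, ψ)` a unitary character of `M\𝐌`»).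
* [Garrett2018] P. Garrett, *Modern Analysis of Automorphic Forms by Example* 1 (2018), §2.8 (constant term via the Bruhat decomposition).
-/

set_option autoImplicit false
-- the mandated namespace repeats the single-problem summit's segment (`HodgeConjecture.HodgeConjecture`)
set_option linter.dupNamespace false

noncomputable section

open MeasureTheory Measure NumberField IsDedekindDomain Set Filter
open scoped ENNReal NNReal Topology
open Literature.NumberTheory.Automorphic Literature.NumberTheory.Automorphic.UnitaryGroup AdelicGroupData
open Literature.NumberTheory.Automorphic.Arthur2013.Leaves.TECR
open Literature.NumberTheory.GaloisRepresentations (HeckeCharacter)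
open Summit.HodgeConjecture.HodgeConjecture.Cruxes.H413.K2E1BorelEisensteinU
open Summit.HodgeConjecture.HodgeConjecture.Cruxes.H413.K2E1CharacterEisensteinU3PairDefs
open Summit.HodgeConjecture.HodgeConjecture.Cruxes.H413.K2E1EisensteinSeriesLeftRight (borelConstantTerm_eisensteinSeriesU_three)
open Summit.HodgeConjecture.HodgeConjecture.Cruxes.H413.K2E1EisensteinAnalyticBinders (hfin_of_locallyUniformMajorant)
open Summit.HodgeConjecture.HodgeConjecture.Cruxes.H413.K2E1BorelEisensteinGodementCMThree (exists_locallyUniform_majorant_flatSectionU_cm_three)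
open Summit.HodgeConjecture.HodgeConjecture.Cruxes.H413.K2E1HeisenbergHaarU3 (isInvInvariant_of_isHaarMeasure_adelicUnipotent_three)

namespace Summit.HodgeConjecture.HodgeConjecture.Cruxes.H413.K2E1ChiEisensteinConstantTermCMThree

variable (L : Type) [Field L] [NumberField L] [IsCMField L]
variable [MeasurableSpace (quasiSplit (↥(maximalRealSubfield L)) L (IsCMField.complexConj L) 3).Adelic] [BorelSpace (quasiSplit (↥(maximalRealSubfield L)) L (IsCMField.complexConj L) 3).Adelic]

/-! ## §1 Section-generic: `E_B(f_z)(g) = f_z(g) + (ν𝓕)⁻¹ · ∫_{N(𝔸)} f_z(w₀ v g) dν` for bounded continuous `φ` left-invariant under `N(𝔸)` and `B(L⁺)`, `Re z > 2` -/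

/-- **THE BOREL CONSTANT TERM OF `E(φH^z)` ON `Re z > 2`, SECTION-GENERIC, `U(2,1)` at the CM pair `(L⁺, L)`**: for a Haar measure `ν` of the Heisenberg radical `N(𝔸_{L⁺})`, a fundamental
domain `𝓕` of `N(L⁺)` with compact closure, a CONTINUOUS BOUNDED `φ : U(J₃)(𝔸) → ℂ` (`‖φ‖ ≤ M`) that is left-`N(𝔸_{L⁺})`- and left-`B(L⁺)`-invariant, `2 < Re z` and every `g`:
`E(f_z)_B(g) = f_z(g) + (ν𝓕)⁻¹ · ∫_{N(𝔸)} f_z(w₀ v g) dν(v)`, `f_z = flatSectionU φ z = φ·H^z` — ★ CT `borelConstantTerm_eisensteinSeriesU_three` with its Godement binder `hfin` discharged by ★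
`hfin_of_locallyUniformMajorant` ∘ ★ `exists_locallyUniform_majorant_flatSectionU_cm_three`, `ν` inversion-invariant ★ (Heisenberg group unimodular), `0 < ν(𝓕) < ∞` ★.
[cite: MoeglinWaldspurger1995, II.1.7] [cite: Garrett2018, §2.8] -/
theorem borelConstantTerm_eisensteinSeriesU_flatSectionU_cm_three (ν : Measure ↥(adelicUnipotent (↥(maximalRealSubfield L)) L (IsCMField.complexConj L) 3)) [ν.IsHaarMeasure]
    {𝓕 : Set ↥(adelicUnipotent (↥(maximalRealSubfield L)) L (IsCMField.complexConj L) 3)} (h𝓕N : IsFundamentalDomain ↥(rationalUnipotent (↥(maximalRealSubfield L)) L (IsCMField.complexConj L) 3) 𝓕 ν) (h𝓕c : IsCompact (closure 𝓕))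
    {φ : (quasiSplit (↥(maximalRealSubfield L)) L (IsCMField.complexConj L) 3).Adelic → ℂ} (hφc : Continuous φ) {M : ℝ} (hφM : ∀ x, ‖φ x‖ ≤ M)
    (hφN : ∀ (n : ↥(adelicUnipotent (↥(maximalRealSubfield L)) L (IsCMField.complexConj L) 3)) (y : (quasiSplit (↥(maximalRealSubfield L)) L (IsCMField.complexConj L) 3).Adelic),
      φ ((n : (quasiSplit (↥(maximalRealSubfield L)) L (IsCMField.complexConj L) 3).Adelic) * y) = φ y)
    (hφB : ∀ b ∈ borelU ((IsCMField.complexConj L : L ≃ₐ[↥(maximalRealSubfield L)] L) : L →+* L) ((StdForm.antidiagonal 3).over L), ∀ x : (quasiSplit (↥(maximalRealSubfield L)) L (IsCMField.complexConj L) 3).Adelic,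
      φ ((quasiSplit (↥(maximalRealSubfield L)) L (IsCMField.complexConj L) 3).toAdelic b * x) = φ x)
    {z : ℂ} (hz : 2 < z.re) (g : (quasiSplit (↥(maximalRealSubfield L)) L (IsCMField.complexConj L) 3).Adelic) :
    borelConstantTerm ν 𝓕 (eisensteinSeriesU (flatSectionU φ z)) g =
      flatSectionU φ z g + ((ν 𝓕).toReal⁻¹ : ℝ) • ∫ v : ↥(adelicUnipotent (↥(maximalRealSubfield L)) L (IsCMField.complexConj L) 3),
        flatSectionU φ z ((quasiSplit (↥(maximalRealSubfield L)) L (IsCMField.complexConj L) 3).toAdelic (weylLongU ((IsCMField.complexConj L : L ≃ₐ[↥(maximalRealSubfield L)] L) : L →+* L) (rfl : (StdForm.antidiagonal 3).over L = (StdForm.antidiagonal 3).over L)) *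
          (v : (quasiSplit (↥(maximalRealSubfield L)) L (IsCMField.complexConj L) 3).Adelic) * g) ∂ν := by
  haveI := t2Space_adeleRing_of_numberField L
  haveI := locallyCompactSpace_adeleRing' L
  haveI : T2Space (quasiSplit (↥(maximalRealSubfield L)) L (IsCMField.complexConj L) 3).Adelic := inferInstanceAs (T2Space (adelic (↥(maximalRealSubfield L)) L (IsCMField.complexConj L) 3 ((StdForm.antidiagonal 3).over L)))
  have hc : IsCMField.complexConj L * IsCMField.complexConj L = 1 := AlgEquiv.ext fun x => IsCMField.complexConj_apply_apply L x
  haveI : ν.IsInvInvariant := isInvInvariant_of_isHaarMeasure_adelicUnipotent_three hc ν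
  have h𝓕₀ : ν 𝓕 ≠ 0 := measure_ne_zero_of_isFundamentalDomain_rationalUnipotent ν h𝓕N
  have h𝓕top : ν 𝓕 ≠ ∞ := ((measure_mono subset_closure).trans_lt h𝓕c.measure_lt_top).ne
  -- the flat section: Borel (indeed continuous), left-`N(𝔸)`- and `B(L⁺)`-invariant, Godement-finite at `g` (`Re z > 2`)
  have hfm : Measurable (flatSectionU φ z) := (continuous_flatSectionU hφc z).measurable
  have hfN : ∀ (n : ↥(adelicUnipotent (↥(maximalRealSubfield L)) L (IsCMField.complexConj L) 3)) (y : (quasiSplit (↥(maximalRealSubfield L)) L (IsCMField.complexConj L) 3).Adelic),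
      flatSectionU φ z ((n : (quasiSplit (↥(maximalRealSubfield L)) L (IsCMField.complexConj L) 3).Adelic) * y) = flatSectionU φ z y := fun n y => by
    rw [flatSectionU_apply, flatSectionU_apply, hφN n y, borelHeight_unipotent_mul n.2 y]
  have hfB := flatSectionU_toAdelic_mul hφB z
  have hfin := hfin_of_locallyUniformMajorant ν hfB (fun q => (continuous_flatSectionU hφc z).comp (continuous_const.mul continuous_id))
    (exists_locallyUniform_majorant_flatSectionU_cm_three L hz (φ := φ) (M := M) hφM) h𝓕c g
  exact borelConstantTerm_eisensteinSeriesU_three ν hfm hfN hfB h𝓕N h𝓕₀ h𝓕top g hfin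

/-! ## §2 The `(χ₁, χ₂)`-twin: pair-sections with automorphic `χ₂` -/

/-- **THE BOREL CONSTANT TERM OF THE `(χ₁, χ₂)`-EISENSTEIN SERIES `E(f_z)`, `f_z = φ·H^z`, ON `Re z > 2`** (`U(2,1)` at the CM pair `(L⁺, L)`): for a Hecke character `χ₁` of `L`, an AUTOMORPHIC
character `χ₂` of the `U(1)`-torus, a CONTINUOUS BOUNDED `(χ₁, χ₂)`-SECTION `φ` (★ `IsChiSectionPair`: `φ(b g) = χ₁(b₀₀)·χ₂(b₁₁)·φ(g)`), a Haar measure `ν` of `N(𝔸_{L⁺})`, a fundamental domain `𝓕`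
of `N(L⁺)` with compact closure, `2 < Re z` and every `g`: `E(f_z)_B(g) = f_z(g) + (ν𝓕)⁻¹ · ∫_{N(𝔸)} f_z(w₀ v g) dν(v)` — §1, the invariances being ★ `IsChiSectionPair.unipotent_mul`
(`u₀₀ = 1 = u₁₁`) and ★ `IsChiSectionPair.toAdelic_mul` (`χ₁` trivial on principal ideles, `χ₂` automorphic on the principal `γ₁₁`).  The second summand is the (un-normalised) intertwining
integral `M(w₀, z)f_z(g)`. [cite: MoeglinWaldspurger1995, II.1.7] [cite: Rogawski1990, §13.9 p. 229] [cite: Garrett2018, §2.8] -/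
theorem borelConstantTerm_chiPairEisenstein_cm_three (ν : Measure ↥(adelicUnipotent (↥(maximalRealSubfield L)) L (IsCMField.complexConj L) 3)) [ν.IsHaarMeasure]
    {𝓕 : Set ↥(adelicUnipotent (↥(maximalRealSubfield L)) L (IsCMField.complexConj L) 3)} (h𝓕N : IsFundamentalDomain ↥(rationalUnipotent (↥(maximalRealSubfield L)) L (IsCMField.complexConj L) 3) 𝓕 ν) (h𝓕c : IsCompact (closure 𝓕))
    {χ₁ : HeckeCharacter L} {χ₂ : ↥(TorusDict.torus (IsCMField.complexConj L)) →ₜ* ℂˣ} (hχ₂ : TorusDict.IsAutomorphic (IsCMField.complexConj L) χ₂)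
    {φ : (quasiSplit (↥(maximalRealSubfield L)) L (IsCMField.complexConj L) 3).Adelic → ℂ} (hφ : IsChiSectionPair χ₁ χ₂ φ) (hφc : Continuous φ) {M : ℝ} (hφM : ∀ x, ‖φ x‖ ≤ M)
    {z : ℂ} (hz : 2 < z.re) (g : (quasiSplit (↥(maximalRealSubfield L)) L (IsCMField.complexConj L) 3).Adelic) :
    borelConstantTerm ν 𝓕 (eisensteinSeriesU (flatSectionU φ z)) g =
      flatSectionU φ z g + ((ν 𝓕).toReal⁻¹ : ℝ) • ∫ v : ↥(adelicUnipotent (↥(maximalRealSubfield L)) L (IsCMField.complexConj L) 3),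
        flatSectionU φ z ((quasiSplit (↥(maximalRealSubfield L)) L (IsCMField.complexConj L) 3).toAdelic (weylLongU ((IsCMField.complexConj L : L ≃ₐ[↥(maximalRealSubfield L)] L) : L →+* L) (rfl : (StdForm.antidiagonal 3).over L = (StdForm.antidiagonal 3).over L)) *
          (v : (quasiSplit (↥(maximalRealSubfield L)) L (IsCMField.complexConj L) 3).Adelic) * g) ∂ν :=
  borelConstantTerm_eisensteinSeriesU_flatSectionU_cm_three L ν h𝓕N h𝓕c hφc hφM hφ.unipotent_mul (hφ.toAdelic_mul hχ₂) hz g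

/-- **`E(f_z)_B(g) = f_z(g) + (ν𝓕)⁻¹ · ∫_{N(𝔸)} f_z(w₀ (v g)) dν(v)`** — §2 in the `ℂ`-multiplicative, `w₀·(v·g)`-associated spelling the S2_χ constant-term letter `hct` of rows 4b∕6 consumes
(`(ν𝓕)⁻¹` cast to `ℂ`, `Complex.real_smul`, `mul_assoc`). [cite: MoeglinWaldspurger1995, II.1.7] [cite: Rogawski1990, §13.9 p. 229] -/
theorem borelConstantTerm_chiPairEisenstein_cm_three_eq_add_mul (ν : Measure ↥(adelicUnipotent (↥(maximalRealSubfield L)) L (IsCMField.complexConj L) 3)) [ν.IsHaarMeasure]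
    {𝓕 : Set ↥(adelicUnipotent (↥(maximalRealSubfield L)) L (IsCMField.complexConj L) 3)} (h𝓕N : IsFundamentalDomain ↥(rationalUnipotent (↥(maximalRealSubfield L)) L (IsCMField.complexConj L) 3) 𝓕 ν) (h𝓕c : IsCompact (closure 𝓕))
    {χ₁ : HeckeCharacter L} {χ₂ : ↥(TorusDict.torus (IsCMField.complexConj L)) →ₜ* ℂˣ} (hχ₂ : TorusDict.IsAutomorphic (IsCMField.complexConj L) χ₂)
    {φ : (quasiSplit (↥(maximalRealSubfield L)) L (IsCMField.complexConj L) 3).Adelic → ℂ} (hφ : IsChiSectionPair χ₁ χ₂ φ) (hφc : Continuous φ) {M : ℝ} (hφM : ∀ x, ‖φ x‖ ≤ M)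
    {z : ℂ} (hz : 2 < z.re) (g : (quasiSplit (↥(maximalRealSubfield L)) L (IsCMField.complexConj L) 3).Adelic) :
    borelConstantTerm ν 𝓕 (eisensteinSeriesU (flatSectionU φ z)) g =
      flatSectionU φ z g + ((((ν 𝓕).toReal⁻¹ : ℝ)) : ℂ) * ∫ v : ↥(adelicUnipotent (↥(maximalRealSubfield L)) L (IsCMField.complexConj L) 3),
        flatSectionU φ z ((quasiSplit (↥(maximalRealSubfield L)) L (IsCMField.complexConj L) 3).toAdelic (weylLongU ((IsCMField.complexConj L : L ≃ₐ[↥(maximalRealSubfield L)] L) : L →+* L) (rfl : (StdForm.antidiagonal 3).over L = (StdForm.antidiagonal 3).over L)) *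
          ((v : (quasiSplit (↥(maximalRealSubfield L)) L (IsCMField.complexConj L) 3).Adelic) * g)) ∂ν := by
  rw [borelConstantTerm_chiPairEisenstein_cm_three L ν h𝓕N h𝓕c hχ₂ hφ hφc hφM hz g, Complex.real_smul]
  simp only [mul_assoc]

end Summit.HodgeConjecture.HodgeConjecture.Cruxes.H413.K2E1ChiEisensteinConstantTermCMThree

end
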